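import Summits.CriticalPhenomena.PercolationContinuityZ3.Theorems.PercNearOneGluingNoHeavyQuantGatedSliceMixLawQHGiantRoute
import Summits.CriticalPhenomena.PercolationContinuityZ3.Theorems.PercNearOneGluingNoHeavyQuantLawDecUsageMonge
import Summits.CriticalPhenomena.PercolationContinuityZ3.Theorems.PercNearOneGluingNoHeavyQuantFlowPieces
import HarnessLib

/-!
# QUANT lane R8, T-DEC, leg (III), blob case — `LawDec.GatedSliceMixLaw'`, Q-ALONE side: cell QH (`2S < t`) with the top `k₂` a GIANT
# (classes `LmGG`, `LMGG`: `k₁ ≥ 1` a `t`-low, the twin `k₁ + a ≤ j` a mid, `k₂ ≥ j+1`) ⟹ the moved law `Q` is DEC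

builds on p205010 (kernel theorem, internal audit signed; external expert review pending)

Support file (`--supports stmt-CriticalPhenomena-4575`), QUANT lane seat prim-quant-arm-1 (gen 41), rung R8 of `run/shared/lean/prim/quant/LADDER.md`.
Theorems only, standard axioms, no sorries, no definitions.  Uses `…QRouting` (`mixLawQ_decAtT_of_routing`: lows `{0,k₁}`, absorbers the twin
`P = k₁ + a`, the top `K = k₂` — here a giant — and `G = k₂ + a`).  ROUTING (`u = y/(1−y)`): the low `k₁` fills the twin first; the overflow and the
zero ride the two giants (pooled capacity `C + D`, split proportionally).  CERTIFICATES (exact census `work/explore/qQK.py`, class `KGH`: 22 093 / 0;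
without `2S < t` the class has genuine mixtures — 165 non-DEC in 42 175 — so the blob hypothesis is load-bearing):
* twin CLOSED to `k₁` (`2k₁ + a ≤ t`): `y(z + A) ≤ (1−y)(C + D)`, affine in `y`, at `y = S/k₂` it is `m(1−λ)(Sg − k₁) ≥ 0` (`S ≥ 2k₁`, `g > 1/2`);
* twin open and `k₁` fits: the zero fits the leftovers termwise (mean identity, `usage_mid_mul_le`, `y·k₂ ≤ S ≤ t`);
* twin open and `k₁` saturates it (`cap = B/usage(k₁,P)`): `y(z + A − cap) ≤ (1−y)(C + D)` — heavy pair: `(y − C − D)(t − 2k₁) ≤ yBa`, affine in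
  `y`, at `y = S/k₂` it is `m(1−λ)(S·g·a − k₁(t − 2k₁)) ≥ 0` (case `ga ≥ k₁`: `S ≥ m(k₁ + λ(a+1))`; case `ga < k₁`: `S ≤ agm`); light pair:
  `y − C − D ≤ B`, `γ ≤ y`.
* **`mixLawQ_decAtT_qh_giantTop`**, `mixLawQ_decAtT_qh_giantTop_open`; the routing step `mixLawQ_decAtT_qh_route` and the closed-twin case
  `mixLawQ_decAtT_qh_giantTop_closed` are part 1 (`…QHGiantRoute`).
HONEST STATUS: cells QK/QH/Q4 assemblies pending; `GatedSliceMixLaw'` (regime R), CW, `GateMove`, `GatedConvEmptyFree`, `SingleGateConvClosed`,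
`TreeDEC`, `FarTreeRow` OPEN; RATE class log\* / honest sentence unchanged.

[this work]; node: prim-quant-stmt g29/g30 (this lane).  Nothing here is cited as a published result.  The gluing rows served
[cite: KozmaNitzan2024, Conjecture 3 (p. 15)]; product measure [cite: Grimmett1999, §1.3 p. 10].
-/

noncomputable section

namespace Summit.CriticalPhenomena.PercolationContinuityZ3.Theorems

namespace Quant

open Finset

/-- the two-point law `{lo, hi; g}` (as in `…QuantLawDEC`) -/
local notation3 "TP[" lo ", " hi ", " g ", " h "]" =>
  (g : ℝ) * (if (h : ℕ) = (hi : ℕ) then (1 : ℝ) else 0) + (1 - (g : ℝ)) * (if (h : ℕ) = (lo : ℕ) then (1 : ℝ) else 0)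

namespace LawDec
set_option maxHeartbeats 800000 in
/-- **cell QH, giant top, twin OPEN to `k₁` (`t < 2k₁ + a`) ⟹ `Q` is DEC.** [this work] -/
theorem mixLawQ_decAtT_qh_giantTop_open (y z g S lam : ℝ) (a j M k₁ k₂ : ℕ)
    (hy0 : 0 < y) (hy1 : y < 1) (hz0 : 0 ≤ z) (hz1 : z < 1) (hg1 : g ≤ 1) (hyg : y ≤ (1 - z) * g) (ha : 1 ≤ a)
    (hta : y * (M : ℝ) ≤ S) (hk : k₁ ≤ k₂) (hk₂M : k₂ ≤ M) (hlam0 : 0 ≤ lam) (hlam1 : lam ≤ 1)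
    (hmean : (1 - z) * ((k₁ : ℝ) + ((k₂ : ℝ) - k₁) * lam) = S)
    (hk₁ : 1 ≤ k₁) (hk₁j : k₁ ≤ j) (hk₁low : 2 * (k₁ : ℝ) < S + (a : ℝ) * g * (1 - z))
    (hPj : k₁ + a ≤ j) (hPmid : S + (a : ℝ) * g * (1 - z) ≤ 2 * ((k₁ + a : ℕ) : ℝ))
    (hKG : j + 1 ≤ k₂)
    (hQH : 2 * S < S + (a : ℝ) * g * (1 - z)) (hPcomp : S + (a : ℝ) * g * (1 - z) < (k₁ : ℝ) + ((k₁ + a : ℕ) : ℝ)) :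
    DECAtT y (S + (a : ℝ) * g * (1 - z)) j (M + a)
      (fun p => z * (if p = 0 then (1 : ℝ) else 0) + (1 - z) * slice (fun q => TP[k₁, k₂, lam, q]) a g p) := by
  set t : ℝ := S + (a : ℝ) * g * (1 - z) with ht
  set A : ℝ := (1 - z) * (1 - lam) * (1 - g) with hA
  set B : ℝ := (1 - z) * (1 - lam) * g with hB
  set C : ℝ := (1 - z) * lam * (1 - g) with hC
  set D : ℝ := (1 - z) * lam * g with hD
  have hg0 : 0 < g := by
    by_contra hc
    have : (1 - z) * g ≤ 0 := mul_nonpos_of_nonneg_of_nonpos (by linarith) (not_lt.1 hc)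
    linarith
  have h1z : 0 < 1 - z := by linarith
  have h1y : 0 < 1 - y := by linarith
  have hA0 : 0 ≤ A := mul_nonneg (mul_nonneg h1z.le (by linarith)) (by linarith)
  have hB0 : 0 ≤ B := mul_nonneg (mul_nonneg h1z.le (by linarith)) hg0.le
  have hC0 : 0 ≤ C := mul_nonneg (mul_nonneg h1z.le hlam0) (by linarith)
  have hD0 : 0 ≤ D := mul_nonneg (mul_nonneg h1z.le hlam0) hg0.le
  have hCD : C + D = (1 - z) * lam := by rw [hC, hD]; ring
  have hkr : (k₁ : ℝ) ≤ k₂ := by exact_mod_cast hk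
  have hk₁r : (1 : ℝ) ≤ k₁ := by exact_mod_cast hk₁
  have ha1 : (1 : ℝ) ≤ a := by exact_mod_cast ha
  have ht0 : 0 < t := by linarith
  have hPr : ((k₁ + a : ℕ) : ℝ) = (k₁ : ℝ) + a := by push_cast; ring
  have hPng : ¬ (j + 1 ≤ k₁ + a) := by omega
  have hG : j + 1 ≤ k₂ + a := by omega
  have hKr : (0 : ℝ) < k₂ := by linarith
  have hmass : z + A + B + C + D = 1 := by rw [hA, hB, hC, hD]; ring
  have hyK : y * (k₂ : ℝ) ≤ S := (mul_le_mul_of_nonneg_left (by exact_mod_cast hk₂M) hy0.le).trans hta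
  have hya : y * (a : ℝ) ≤ (a : ℝ) * g * (1 - z) := by
    have := mul_le_mul_of_nonneg_right hyg (Nat.cast_nonneg a)
    linarith [show (1 - z) * g * (a : ℝ) = (a : ℝ) * g * (1 - z) by ring]
  have hSt : S ≤ t := by
    have : 0 ≤ (a : ℝ) * g * (1 - z) := mul_nonneg (mul_nonneg (Nat.cast_nonneg a) hg0.le) h1z.le
    rw [ht]; linarith
  have hyKt : y * (k₂ : ℝ) ≤ t := hyK.trans hSt
  have hyG : y * ((k₂ : ℝ) + a) ≤ t := by rw [mul_add, ht]; linarith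
  have hyP : y * (((k₁ + a : ℕ) : ℝ)) ≤ t := by
    rw [hPr, mul_add, ht]
    have : y * (k₁ : ℝ) ≤ y * k₂ := mul_le_mul_of_nonneg_left hkr hy0.le
    linarith
  have huK : usage y t j k₁ k₂ = y / (1 - y) := usage_giant_eq y t j k₁ k₂ hKG
  have huG : usage y t j k₁ (k₂ + a) = y / (1 - y) := usage_giant_eq y t j k₁ (k₂ + a) hG
  -- `K·mλ − S = −m k₁ (1−λ)`
  have hKS : (k₂ : ℝ) * ((1 - z) * lam) - S = -((1 - z) * k₁ * (1 - lam)) := by rw [← hmean]; ring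
  have hS0 : 0 < S := by
    have h0 : 0 ≤ (1 - z) * (((k₂ : ℝ) - k₁) * lam) := mul_nonneg h1z.le (mul_nonneg (sub_nonneg.2 hkr) hlam0)
    have h1 : (1 - z) * (k₁ : ℝ) ≤ S := by
      rw [← hmean]; linarith [h0, show (1 - z) * ((k₁ : ℝ) + ((k₂ : ℝ) - k₁) * lam) = (1 - z) * k₁ + (1 - z) * (((k₂ : ℝ) - k₁) * lam) by ring]
    have h2 : (1 - z) * 1 ≤ (1 - z) * (k₁ : ℝ) := mul_le_mul_of_nonneg_left hk₁r h1z.le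
    linarith
  have hU0 : 0 ≤ usage y t j k₁ (k₁ + a) := by
    have hγ0 : 0 < pairGate y t k₁ (k₁ + a) := pairGate_pos y t k₁ (k₁ + a) hk₁low (by omega)
    have hγ1 : pairGate y t k₁ (k₁ + a) < 1 := pairGate_lt_one y t k₁ (k₁ + a) hy0 hy1 hk₁low hPcomp
    simp only [usage, gateOf, if_neg hPng]
    exact div_nonneg hγ0.le (by linarith)
  have hUP : t < ((k₁ + a : ℕ) : ℝ) → usage y t j k₁ (k₁ + a) * (((k₁ + a : ℕ) : ℝ) - t) ≤ t - k₁ :=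
    fun _ => usage_mid_mul_le y t j k₁ (k₁ + a) hy0 hy1 hk₁low hPj hPcomp hyP
  by_cases hfits : usage y t j k₁ (k₁ + a) * A ≤ B
  · -- `k₁` fits in the twin: the zero rides the twin's leftover and the giants (termwise, mean identity)
    have hmom : (k₁ : ℝ) * A + ((k₁ : ℝ) + a) * B + (k₂ : ℝ) * C + ((k₂ : ℝ) + a) * D = t := by
      rw [hA, hB, hC, hD, ht, ← hmean]; ring
    have htz : t * z = -((t - k₁) * A) - (t - ((k₁ : ℝ) + a)) * B - (t - k₂) * C + ((k₂ : ℝ) + a - t) * D := by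
      have e1 : t * z = t * (1 - A - B - C - D) := by rw [← hmass]; ring
      rw [e1]; linarith [hmom]
    have hKt : -((t - (k₂ : ℝ)) * C) ≤ t * (1 - y) / y * C := by
      have h1 : ((k₂ : ℝ) - t) ≤ t * (1 - y) / y := by
        rw [le_div_iff₀ hy0]
        linarith [hyKt, show ((k₂ : ℝ) - t) * y = y * k₂ - t * y by ring, show t * (1 - y) = t - t * y by ring]
      have h2 := mul_le_mul_of_nonneg_right h1 hC0
      linarith [h2, show -((t - (k₂ : ℝ)) * C) = ((k₂ : ℝ) - t) * C by ring]
    have hGt : ((k₂ : ℝ) + a - t) * D ≤ t * (1 - y) / y * D := by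
      have h1 : ((k₂ : ℝ) + a - t) ≤ t * (1 - y) / y := by
        rw [le_div_iff₀ hy0]
        linarith [hyG, show ((k₂ : ℝ) + a - t) * y = y * ((k₂ : ℝ) + a) - t * y by ring, show t * (1 - y) = t - t * y by ring]
      exact mul_le_mul_of_nonneg_right h1 hD0
    have hPt := qh_twin_term t (k₁ : ℝ) (a : ℝ) (((k₁ + a : ℕ) : ℝ)) (usage y t j k₁ (k₁ + a)) A B hPr hUP hA0 hB0 (by linarith)
    have e0 : t * (1 - y) / y * C + t * (1 - y) / y * D = t * (1 - y) / y * (C + D) := by ring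
    have hoff : t * z ≤ (if t < ((k₁ + a : ℕ) : ℝ) then ((k₁ + a : ℕ) : ℝ) - t else 0) * (B - usage y t j k₁ (k₁ + a) * A)
        + t * (1 - y) / y * (C + D) - t * 0 := by
      rw [mul_zero, sub_zero]; linarith [hKt, hGt, hPt, e0, htz]
    exact mixLawQ_decAtT_qh_route y z g S lam a j M k₁ k₂ hy0 hy1 hz0 hz1 hg1 hyg ha hta hk hk₂M hlam0 hlam1 hmean hk₁ hk₁j hk₁low hPj hPmid
      hKG A 0 hA0 le_rfl (by rw [hA]; ring) (fun _ => hPcomp) hfits (by rw [mul_zero]; exact mul_nonneg h1y.le (by linarith)) hoff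
  · -- `k₁` saturates the twin
    have hsat : B < usage y t j k₁ (k₁ + a) * A := not_le.1 hfits
    have hUpos : 0 < usage y t j k₁ (k₁ + a) := by
      rcases lt_or_eq_of_le hU0 with h | h
      · exact h
      · rw [← h, zero_mul] at hsat; linarith
    set W₁ : ℝ := t - 2 * (k₁ : ℝ) with hW₁
    have hW₁0 : 0 < W₁ := by rw [hW₁]; linarith
    have ha0 : (0 : ℝ) < a := by linarith
    have hd₁ : ((k₁ + a : ℕ) : ℝ) - (k₁ : ℝ) = a := by rw [hPr]; ring
    set ρ₁ : ℝ := W₁ / a with hρ₁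
    have hρ0 : 0 < ρ₁ := div_pos hW₁0 ha0
    have hWa : W₁ < a := by rw [hW₁]; rw [hPr] at hPcomp; linarith
    -- the saturation step: `cap` of `k₁` fills the twin; certificate `y(z + A − cap) ≤ (1−y)(C+D)`
    have main : ∀ cap : ℝ, 0 ≤ cap → usage y t j k₁ (k₁ + a) * cap = B → y * (z + A - cap) ≤ (1 - y) * (C + D) →
        DECAtT y t j (M + a)
      (fun p => z * (if p = 0 then (1 : ℝ) else 0) + (1 - z) * slice (fun q => TP[k₁, k₂, lam, q]) a g p) := by
      intro cap hcap0 hsatP hE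
      have hcapA : cap < A := by
        by_contra hc
        have : usage y t j k₁ (k₁ + a) * A ≤ usage y t j k₁ (k₁ + a) * cap := mul_le_mul_of_nonneg_left (not_lt.1 hc) hUpos.le
        rw [hsatP] at this; linarith
      have h1 : t * z + t * (A - cap) ≤ t * (1 - y) / y * (C + D) := by
        have e : t * (1 - y) / y * (C + D) = t * ((1 - y) * (C + D) / y) := by ring
        rw [e, ← mul_add]
        refine mul_le_mul_of_nonneg_left ?_ ht0.le
        rw [le_div_iff₀ hy0]; linarith
      have hoff : t * z ≤ (if t < ((k₁ + a : ℕ) : ℝ) then ((k₁ + a : ℕ) : ℝ) - t else 0) * (B - usage y t j k₁ (k₁ + a) * cap)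
          + t * (1 - y) / y * (C + D) - t * (A - cap) := by
        rw [hsatP, sub_self, mul_zero, zero_add]; linarith
      exact mixLawQ_decAtT_qh_route y z g S lam a j M k₁ k₂ hy0 hy1 hz0 hz1 hg1 hyg ha hta hk hk₂M hlam0 hlam1 hmean hk₁ hk₁j hk₁low hPj hPmid
        hKG cap (A - cap) hcap0 (by linarith) (by rw [hA]; ring) (fun _ => hPcomp) (le_of_eq hsatP)
        (by have := mul_nonneg hy0.le hz0; linarith [hE, show y * (z + A - cap) = y * z + y * (A - cap) by ring]) hoff
    have hzA : z + A = 1 - B - (C + D) := by linarith [hmass]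
    by_cases hheavy : y * (a : ℝ) ≤ W₁
    · have hyρ : y ≤ ρ₁ := by rw [hρ₁, le_div_iff₀ ha0]; exact hheavy
      have huP : usage y t j k₁ (k₁ + a) = ρ₁ / (1 - ρ₁) := by
        have hmax : y ^ 2 + (1 - y) * ρ₁ ≤ ρ₁ := by
          have h := mul_nonpos_of_nonneg_of_nonpos hy0.le (sub_nonpos.2 hyρ)
          linarith [h, show y ^ 2 + (1 - y) * ρ₁ = ρ₁ + y * (y - ρ₁) by ring]
        simp only [usage, gateOf, if_neg hPng, pairGate]
        rw [hd₁, ← hW₁, ← hρ₁, max_eq_left hmax]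
      set cap : ℝ := B * (1 - ρ₁) / ρ₁ with hcapdef
      have hρlt1 : ρ₁ < 1 := by rw [hρ₁, div_lt_one ha0]; exact hWa
      have hcap0 : 0 ≤ cap := div_nonneg (mul_nonneg hB0 (by linarith)) hρ0.le
      have hsatP : usage y t j k₁ (k₁ + a) * cap = B := by
        have hρne : 1 - ρ₁ ≠ 0 := ne_of_gt (by linarith)
        have hρne0 : ρ₁ ≠ 0 := ne_of_gt hρ0
        rw [huP, hcapdef, div_mul_div_comm, mul_comm (1 - ρ₁) ρ₁, ← mul_assoc]
        rw [mul_div_mul_right _ _ hρne, mul_comm ρ₁ B, mul_div_assoc, div_self hρne0, mul_one]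
      have hcapW : cap * W₁ = B * (a - W₁) := by
        have hane : (a : ℝ) ≠ 0 := ne_of_gt ha0
        have hWne : W₁ ≠ 0 := ne_of_gt hW₁0
        rw [hcapdef, hρ₁]; field_simp
      refine main cap hcap0 hsatP ?_
      -- heavy certificate `(y − C − D)W₁ ≤ yBa`: affine in `y`, checked at `0` and at `y = S/K`
      have hend : (S - (k₂ : ℝ) * (C + D)) * W₁ ≤ S * B * a := by
        have e : S * B * a - (S - (k₂ : ℝ) * (C + D)) * W₁ = (1 - z) * (1 - lam) * (S * g * a - k₁ * W₁) := by
          rw [hB, hCD]; linear_combination W₁ * hKS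
        have hcore : (k₁ : ℝ) * W₁ ≤ S * g * a := by
          rw [hW₁]
          by_cases hga : (k₁ : ℝ) ≤ g * a
          · have hKk : (a : ℝ) + 1 ≤ (k₂ : ℝ) - k₁ := by
              have h3 : k₁ + a + 1 ≤ k₂ := by omega
              have h4 : ((k₁ + a + 1 : ℕ) : ℝ) ≤ k₂ := by exact_mod_cast h3
              push_cast at h4; linarith
            have hSlow : (1 - z) * ((k₁ : ℝ) + lam * (a + 1)) ≤ S := by
              rw [← hmean]; apply mul_le_mul_of_nonneg_left _ h1z.le
              have := mul_le_mul_of_nonneg_left hKk hlam0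
              linarith [this, mul_comm ((k₂ : ℝ) - k₁) lam]
            have key : S * g * a - k₁ * (S + (a : ℝ) * g * (1 - z) - 2 * k₁)
                = (S - (1 - z) * (k₁ + lam * (a + 1))) * (g * a - k₁) + ((k₁ : ℝ) ^ 2 * (2 - (1 - z)) + (1 - z) * lam * (a + 1) * (g * a - k₁)) := by
              ring
            have p1 : 0 ≤ (S - (1 - z) * (k₁ + lam * (a + 1))) * (g * a - k₁) := mul_nonneg (sub_nonneg.2 hSlow) (sub_nonneg.2 hga)
            have p2 : 0 ≤ (k₁ : ℝ) ^ 2 * (2 - (1 - z)) := mul_nonneg (sq_nonneg _) (by linarith)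
            have p3 : 0 ≤ (1 - z) * lam * (a + 1) * (g * a - k₁) :=
              mul_nonneg (mul_nonneg (mul_nonneg h1z.le hlam0) (by linarith)) (sub_nonneg.2 hga)
            rw [ht]; linarith [key, p1, p2, p3]
          · have hga' : g * a < k₁ := not_le.1 hga
            have hSle : S ≤ (a : ℝ) * g * (1 - z) := by linarith
            have key : S * g * a - k₁ * (S + (a : ℝ) * g * (1 - z) - 2 * k₁)
                = ((a : ℝ) * g * (1 - z) - S) * (k₁ - g * a) + ((1 - z) * (a * g) * (a * g - 2 * k₁) + 2 * (k₁ : ℝ) ^ 2) := by ring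
            have p1 : 0 ≤ ((a : ℝ) * g * (1 - z) - S) * (k₁ - g * a) := mul_nonneg (sub_nonneg.2 hSle) (by linarith)
            have p2 : 0 ≤ (1 - z) * (a * g) * (a * g - 2 * k₁) + 2 * (k₁ : ℝ) ^ 2 := by
              by_cases h2k : 2 * (k₁ : ℝ) ≤ a * g
              · have : 0 ≤ (1 - z) * (a * g) * (a * g - 2 * k₁) :=
                  mul_nonneg (mul_nonneg h1z.le (mul_nonneg (Nat.cast_nonneg a) hg0.le)) (by linarith)
                have : 0 ≤ 2 * (k₁ : ℝ) ^ 2 := by positivity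
                linarith
              · -- `X = ag(ag − 2k₁) ≤ 0`, so `(1−z)X ≥ X` and `X + 2k₁² = (ag − k₁)² + k₁²`
                have hX : (a : ℝ) * g * (a * g - 2 * k₁) ≤ 0 :=
                  mul_nonpos_of_nonneg_of_nonpos (mul_nonneg (Nat.cast_nonneg a) hg0.le) (by linarith)
                have h3 : 0 ≤ z * (-((a : ℝ) * g * (a * g - 2 * k₁))) := mul_nonneg hz0 (by linarith)
                have e1 : (1 - z) * ((a : ℝ) * g) * (a * g - 2 * k₁) = (a : ℝ) * g * (a * g - 2 * k₁) + z * (-((a : ℝ) * g * (a * g - 2 * k₁))) := by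
                  ring
                have e2 : (a : ℝ) * g * (a * g - 2 * k₁) + 2 * (k₁ : ℝ) ^ 2 = ((a : ℝ) * g - k₁) ^ 2 + (k₁ : ℝ) ^ 2 := by ring
                have p3 : 0 ≤ ((a : ℝ) * g - k₁) ^ 2 := sq_nonneg _
                have p4 : 0 ≤ (k₁ : ℝ) ^ 2 := sq_nonneg _
                linarith [e1, e2, p3, p4, h3]
            rw [ht]; linarith [key, p1, p2]
        have h7 := mul_nonneg (mul_nonneg h1z.le (sub_nonneg.2 hlam1)) (sub_nonneg.2 hcore)
        linarith [e, h7]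
      have hI : S * (y * B * a - (y - (C + D)) * W₁)
          = (S - y * k₂) * ((C + D) * W₁) + y * (S * B * a - (S - (k₂ : ℝ) * (C + D)) * W₁) := by ring
      have hpos1 : 0 ≤ (S - y * k₂) * ((C + D) * W₁) := mul_nonneg (by linarith) (mul_nonneg (by linarith) hW₁0.le)
      have hpos2 : 0 ≤ y * (S * B * a - (S - (k₂ : ℝ) * (C + D)) * W₁) := mul_nonneg hy0.le (by linarith)
      have hIcPh : (y - (C + D)) * W₁ ≤ y * B * a := by
        have h0 : 0 ≤ S * (y * B * a - (y - (C + D)) * W₁) := by rw [hI]; exact add_nonneg hpos1 hpos2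
        by_contra hc
        have : S * (y * B * a - (y - (C + D)) * W₁) < 0 := mul_neg_of_pos_of_neg hS0 (by linarith)
        linarith
      have h3 : (y - y * B - (C + D)) * W₁ ≤ y * cap * W₁ := by
        have e : y * cap * W₁ = y * B * a - y * B * W₁ := by rw [mul_assoc, hcapW]; ring
        rw [e]; linarith [hIcPh, show (y - y * B - (C + D)) * W₁ = (y - (C + D)) * W₁ - y * B * W₁ by ring]
      have h4 : y - y * B - (C + D) ≤ y * cap := le_of_mul_le_mul_right h3 hW₁0
      rw [hzA]
      linarith [h4, show y * (1 - B - (C + D) - cap) = y - y * B - y * (C + D) - y * cap by ring,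
        show (1 - y) * (C + D) = (C + D) - y * (C + D) by ring]
    · -- light pair
      have hlt : W₁ < y * a := not_le.1 hheavy
      have hρy : ρ₁ < y := by rw [hρ₁, div_lt_iff₀ ha0]; linarith
      set γ : ℝ := y ^ 2 + (1 - y) * ρ₁ with hγ
      have hγ0 : 0 < γ := by
        have h1 : 0 < (1 - y) * ρ₁ := mul_pos h1y hρ0
        rw [hγ]; linarith [sq_nonneg y]
      have hγy : γ ≤ y := by
        have h1 := mul_le_mul_of_nonneg_left hρy.le h1y.le
        rw [hγ]; linarith [h1, show y ^ 2 + (1 - y) * y = y by ring]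
      have hγ1 : γ < 1 := by linarith
      have huP : usage y t j k₁ (k₁ + a) = γ / (1 - γ) := by
        have hmax : ρ₁ ≤ y ^ 2 + (1 - y) * ρ₁ := by
          have h1 := mul_le_mul_of_nonneg_left hρy.le hy0.le
          linarith [h1, show y ^ 2 = y * y by ring, show (1 - y) * ρ₁ = ρ₁ - y * ρ₁ by ring]
        simp only [usage, gateOf, if_neg hPng, pairGate]
        rw [hd₁, ← hW₁, ← hρ₁, max_eq_right hmax]
      set cap : ℝ := B * (1 - γ) / γ with hcapdef
      have hcap0 : 0 ≤ cap := div_nonneg (mul_nonneg hB0 (by linarith)) hγ0.le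
      have hsatP : usage y t j k₁ (k₁ + a) * cap = B := by
        have hγne : 1 - γ ≠ 0 := ne_of_gt (by linarith)
        have hγne0 : γ ≠ 0 := ne_of_gt hγ0
        rw [huP, hcapdef, div_mul_div_comm, mul_comm (1 - γ) γ, ← mul_assoc]
        rw [mul_div_mul_right _ _ hγne, mul_comm γ B, mul_div_assoc, div_self hγne0, mul_one]
      have hcapγ : cap * γ = B * (1 - γ) := by rw [hcapdef]; field_simp
      refine main cap hcap0 hsatP ?_
      have h1 : (y - (C + D)) * γ ≤ y * B := by
        by_cases hyD : y ≤ C + D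
        · have : (y - (C + D)) * γ ≤ 0 := mul_nonpos_of_nonpos_of_nonneg (by linarith) hγ0.le
          linarith [this, mul_nonneg hy0.le hB0]
        · have h2 : (y - (C + D)) * γ ≤ (y - (C + D)) * y := mul_le_mul_of_nonneg_left hγy (by linarith)
          have h3 : y - (C + D) ≤ B := by
            have e : (1 - z) * g = B + D := by rw [hB, hD]; ring
            linarith [hC0, hyg]
          have h4 := mul_le_mul_of_nonneg_left h3 hy0.le
          linarith [h2, h4, show (y - (C + D)) * y = y * (y - (C + D)) by ring]
      have h3 : (y - y * B - (C + D)) * γ ≤ y * cap * γ := by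
        have e : y * cap * γ = y * B - y * B * γ := by rw [mul_assoc, hcapγ]; ring
        rw [e]; linarith [h1, show (y - y * B - (C + D)) * γ = (y - (C + D)) * γ - y * B * γ by ring]
      have h4 : y - y * B - (C + D) ≤ y * cap := le_of_mul_le_mul_right h3 hγ0
      rw [hzA]
      linarith [h4, show y * (1 - B - (C + D) - cap) = y - y * B - y * (C + D) - y * cap by ring,
        show (1 - y) * (C + D) = (C + D) - y * (C + D) by ring]

/-- **CELL QH WITH THE TOP A GIANT ⟹ `Q` IS DEC** (classes `LmGG`, `LMGG`).  See the file header. [this work] -/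
theorem mixLawQ_decAtT_qh_giantTop (y z g S lam : ℝ) (a j M k₁ k₂ : ℕ)
    (hy0 : 0 < y) (hy1 : y < 1) (hz0 : 0 ≤ z) (hz1 : z < 1) (hg1 : g ≤ 1) (hyg : y ≤ (1 - z) * g) (ha : 1 ≤ a)
    (hta : y * (M : ℝ) ≤ S) (hk : k₁ ≤ k₂) (hk₂M : k₂ ≤ M) (hlam0 : 0 ≤ lam) (hlam1 : lam ≤ 1)
    (hmean : (1 - z) * ((k₁ : ℝ) + ((k₂ : ℝ) - k₁) * lam) = S)
    (hk₁ : 1 ≤ k₁) (hk₁j : k₁ ≤ j) (hk₁low : 2 * (k₁ : ℝ) < S + (a : ℝ) * g * (1 - z))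
    (hPj : k₁ + a ≤ j) (hPmid : S + (a : ℝ) * g * (1 - z) ≤ 2 * ((k₁ + a : ℕ) : ℝ))
    (hKG : j + 1 ≤ k₂)
    (hQH : 2 * S < S + (a : ℝ) * g * (1 - z)) :
    DECAtT y (S + (a : ℝ) * g * (1 - z)) j (M + a)
      (fun p => z * (if p = 0 then (1 : ℝ) else 0) + (1 - z) * slice (fun q => TP[k₁, k₂, lam, q]) a g p) := by
  by_cases hcl : (k₁ : ℝ) + ((k₁ + a : ℕ) : ℝ) ≤ S + (a : ℝ) * g * (1 - z)
  · exact mixLawQ_decAtT_qh_giantTop_closed y z g S lam a j M k₁ k₂ hy0 hy1 hz0 hz1 hg1 hyg ha hta hk hk₂M hlam0 hlam1 hmean hk₁ hk₁j hk₁low hPj hPmid hKG hQH hcl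
  · exact mixLawQ_decAtT_qh_giantTop_open y z g S lam a j M k₁ k₂ hy0 hy1 hz0 hz1 hg1 hyg ha hta hk hk₂M hlam0 hlam1 hmean hk₁ hk₁j hk₁low hPj hPmid hKG hQH (not_le.1 hcl)

end LawDec

end Quant

end Summit.CriticalPhenomena.PercolationContinuityZ3.Theorems
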